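import Literature.NumberTheory.Sieve.LinearSieveSecondRange
import Mathlib.Analysis.Complex.ExponentialBounds
import HarnessLib

/-!
# Chen's numerical estimate (33) for the lower-sieve term: `I₁ − ¼ I₂ ≥ −0.016473`

Chen Jing-run, *On the representation of a larger even integer as the sum of a prime and the
product of at most two primes*, Sci. Sinica 16 (1973) 157–176, proof of Lemma 9 (pp. 175–176 of the
original = PDF pp. 167–168 of the reprint in Wang Yuan (ed.), *Goldbach Conjecture*, 1984). With the
sieving level `z = x^{1/10}` the lower bound (31) for `P_x(x, x^{1/10})` carries the factor
`5 f₁(5)/(2e^γ) = log 4 + I₁`, `I₁ = ∫_3^4 (du/u) J(u − 1)`, `J(w) = ∫_2^w log(t − 1)/t dt`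
(`Literature.NumberTheory.Sieve.five_mul_lowerSieveFun_one`, `Literature.NumberTheory.Sieve.linearSieveJ`),
and the upper bound (32) for `∑_{x^{1/10} < p ≤ x^{1/3}} P_x(x, p, x^{1/10})` carries, besides
`4 log 8`, the term `¼ I₂` with `I₂ = ∫_{1/10}^{1/5} dα/(α(½ − α)) J(4 − 10α) = ∫_3^4 10 J(u − 1)/(u(5 − u)) du`
(substitution `u = 5 − 10α`). Chen's (33) is the estimate

  `I₁ − ¼ I₂ = ∫_3^4 (1/u − 2.5/(u(5 − u))) J(u − 1) du ≥ ½ + ¾ log(9/8) − (3/2) log(4/3) − ¼ log 2 ≥ −0.0164725`,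

obtained from "`log x ≤ (x − 1)/2 + (x − 1)/(1 + x)` for `1 ≤ x ≤ 2`", which makes
`J(w) ≤ ∫_2^w (½ − 2/t²) dt = w/2 + 2/w − 2` and turns the (negative) weight times this rational bound
into an elementary integral. This file PROVES it:

* `log_le_half_add_div` — `log x ≤ (x − 1)/2 + (x − 1)/(1 + x)` for all `x ≥ 1`;
* `linearSieveJ_le` — `J(w) ≤ w/2 + 2/w − 2` for `w ≥ 2`;
* `chen_lowerSieveIntegral_ge` — `∫_3^4 ((5/2 − u)/(u(5 − u))) J(u − 1) du ≥ ½ + 3 log 3 − (11/2) log 2`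
  (`= ½ + ¾ log(9/8) − (3/2) log(4/3) − ¼ log 2`);
* `chen_lowerSieveConst_gt` — `½ + 3 log 3 − (11/2) log 2 > −0.016473` (Chen: `≥ −0.0164725`);
* `chen_mainConstant_gt` — the resulting numerical margin of Chen's Theorems I–II with the sharpened
  switching constant of `ChenSwitchingConstantTenth` (`c' < 0.4911`):
  `4 log 2 + 8 (½ + 3 log 3 − (11/2) log 2) − 4 · 0.4911 > 0.676` (Chen: `2.6408 − 1.9702 = 0.6706 ≥ 0.67`).

No named facts; everything is unconditional.

## References

* Chen Jing-run, Sci. Sinica 16 (1973) 157–176, Lemma 9, (31)–(33) (reprint: Wang Yuan (ed.),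
  *Goldbach Conjecture*, World Scientific 1984, PDF pp. 167–168). [ChenSciSinica1973]
-/

noncomputable section

open Real Set MeasureTheory intervalIntegral

namespace Literature.NumberTheory.Sieve.Chen

/-! ### Chen's logarithm bound and the rational bound for `J` -/

/-- Chen's bound "`log x ≤ (x − 1)/2 + (x − 1)/(1 + x)` for `1 ≤ x ≤ 2`" (it holds for all `x ≥ 1`:
the difference vanishes at `1` and has derivative `(x − 1)(x² + x + 2)/(2x(1 + x)²) ≥ 0`).
[cite: ChenSciSinica1973, Lemma 9 eq. (33) (reprint p. 168)] -/
theorem log_le_half_add_div {x : ℝ} (hx : 1 ≤ x) :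
    Real.log x ≤ (x - 1) / 2 + (x - 1) / (1 + x) := by
  let F : ℝ → ℝ := fun s => (s - 1) / 2 + (s - 1) / (1 + s) - Real.log s
  let F' : ℝ → ℝ := fun s => (s - 1) * (s ^ 2 + s + 2) / (2 * s * (1 + s) ^ 2)
  have A : ∀ s : ℝ, 1 ≤ s → HasDerivAt F (F' s) s := by
    intro s hs
    have h0 : s ≠ 0 := by positivity
    have h1 : (1 + s) ≠ 0 := by positivity
    have hq : HasDerivAt (fun t : ℝ => (t - 1) / (1 + t)) ((1 * (1 + s) - (s - 1) * 1) / (1 + s) ^ 2) s :=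
      ((hasDerivAt_id s).sub_const 1).div ((hasDerivAt_id s).const_add 1) h1
    have h : HasDerivAt F (1 / 2 + (1 * (1 + s) - (s - 1) * 1) / (1 + s) ^ 2 - s⁻¹) s :=
      ((((hasDerivAt_id s).sub_const 1).div_const 2).add hq).sub (Real.hasDerivAt_log h0)
    convert h using 1
    simp only [F']
    field_simp
    ring
  suffices MonotoneOn F (Ici 1) by
    have h := this (self_mem_Ici) (mem_Ici.mpr hx) hx
    simp only [F] at h
    norm_num at h
    linarith
  refine monotoneOn_of_hasDerivWithinAt_nonneg (convex_Ici 1)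
    (fun s hs => (A s hs).continuousAt.continuousWithinAt)
    (fun s hs => (A s (interior_subset hs)).hasDerivWithinAt) ?_
  intro s hs
  rw [interior_Ici, Set.mem_Ioi] at hs
  simp only [F']
  have : 0 ≤ s - 1 := by linarith
  positivity

/-- Pointwise: `log(t − 1)/t ≤ ½ − 2/t²` for `t ≥ 2` (Chen's log bound at `x = t − 1`, the `1/t`
terms cancel). [cite: ChenSciSinica1973, Lemma 9 eq. (33) (reprint p. 168)] -/
theorem log_sub_one_div_le {t : ℝ} (ht : 2 ≤ t) :
    Real.log (t - 1) / t ≤ 1 / 2 - 2 / t ^ 2 := by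
  have ht0 : 0 < t := by linarith
  have ht0' : t ≠ 0 := ht0.ne'
  have h := log_le_half_add_div (x := t - 1) (by linarith)
  have e : (t - 1 - 1) / 2 + (t - 1 - 1) / (1 + (t - 1)) = (t - 2) / 2 + (t - 2) / t := by ring
  rw [e] at h
  have heq : 1 / 2 - 2 / t ^ 2 = ((t - 2) / 2 + (t - 2) / t) / t := by
    field_simp
    ring
  rw [heq]
  exact div_le_div_of_nonneg_right h ht0.le

/-- **Chen's rational bound for `J`**: `J(w) = ∫_2^w log(t − 1)/t dt ≤ w/2 + 2/w − 2` for `w ≥ 2`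
(Chen: `∫_2^{u−1} ((t−2)/2 + (t−2)/t) dt/t = ½(u − 3 + 4/(u − 1) − 2)`).
[cite: ChenSciSinica1973, Lemma 9 eq. (33) (reprint p. 168)] -/
theorem linearSieveJ_le {w : ℝ} (hw : 2 ≤ w) : linearSieveJ w ≤ w / 2 + 2 / w - 2 := by
  have hsub : uIcc 2 w ⊆ Ioi 1 := fun t ht => by
    rw [uIcc_of_le hw] at ht
    rw [mem_Ioi]
    linarith [ht.1]
  have hint : IntervalIntegrable (fun t : ℝ => Real.log (t - 1) / t) volume 2 w :=
    (continuousOn_log_sub_one_div.mono hsub).intervalIntegrable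
  have hcont : ContinuousOn (fun t : ℝ => 1 / 2 - 2 / t ^ 2) (Icc 2 w) := by
    refine continuousOn_const.sub (ContinuousOn.div continuousOn_const (by fun_prop) ?_)
    intro t ht h0
    have : (0 : ℝ) < t ^ 2 := by have := ht.1; positivity
    linarith
  have hint' : IntervalIntegrable (fun t : ℝ => 1 / 2 - 2 / t ^ 2) volume 2 w :=
    hcont.intervalIntegrable_of_Icc hw
  have hmono : linearSieveJ w ≤ ∫ t in (2 : ℝ)..w, (1 / 2 - 2 / t ^ 2) :=
    integral_mono_on hw hint hint' fun t ht => log_sub_one_div_le ht.1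
  -- `∫_2^w (½ − 2/t²) dt = w/2 + 2/w − 2`
  have hderiv : ∀ t ∈ uIcc 2 w,
      HasDerivAt (fun t : ℝ => t / 2 + 2 * t⁻¹) (1 / 2 - 2 / t ^ 2) t := by
    intro t ht
    rw [uIcc_of_le hw] at ht
    have ht0 : t ≠ 0 := by
      have := ht.1
      positivity
    have h : HasDerivAt (fun t : ℝ => t / 2 + 2 * t⁻¹) (1 / 2 + 2 * (-(t ^ 2)⁻¹)) t :=
      ((hasDerivAt_id t).div_const 2).add ((hasDerivAt_inv ht0).const_mul 2)
    refine h.congr_deriv ?_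
    field_simp
    ring
  have hI := integral_eq_sub_of_hasDerivAt hderiv hint'
  rw [hI] at hmono
  have hw0 : w ≠ 0 := by
    have := hw
    positivity
  have e1 : w / 2 + 2 * w⁻¹ = w / 2 + 2 / w := by rw [div_eq_mul_inv 2 w]
  have e2 : (2 : ℝ) / 2 + 2 * (2 : ℝ)⁻¹ = 2 := by norm_num
  rw [e1, e2] at hmono
  exact hmono

/-! ### The weighted integral of Chen's (33) -/

/-- Chen's minorant of the weighted integrand: for `3 ≤ u ≤ 4`,
`((5/2 − u)/(u(5 − u))) J(u − 1) ≥ ((5/2 − u)/(u(5 − u))) ((u − 1)/2 + 2/(u − 1) − 2)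
 = ½ − (9/4)/u − (1/4)/(5 − u) + (3/4)/(u − 1)` (the weight is `≤ 0`).
[cite: ChenSciSinica1973, Lemma 9 eq. (33) (reprint p. 168)] -/
theorem chen_lowerSieveMinorant_le {u : ℝ} (h3 : 3 ≤ u) (h4 : u ≤ 4) :
    1 / 2 - 9 / 4 / u - 1 / 4 / (5 - u) + 3 / 4 / (u - 1) ≤
      (5 / 2 - u) / (u * (5 - u)) * linearSieveJ (u - 1) := by
  have hu0 : 0 < u := by linarith
  have hu5 : 0 < 5 - u := by linarith
  have hu1 : 0 < u - 1 := by linarith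
  have hwt : (5 / 2 - u) / (u * (5 - u)) ≤ 0 :=
    div_nonpos_of_nonpos_of_nonneg (by linarith) (mul_pos hu0 hu5).le
  have hJ := linearSieveJ_le (w := u - 1) (by linarith)
  have heq : 1 / 2 - 9 / 4 / u - 1 / 4 / (5 - u) + 3 / 4 / (u - 1) =
      (5 / 2 - u) / (u * (5 - u)) * ((u - 1) / 2 + 2 / (u - 1) - 2) := by
    field_simp
    ring
  rw [heq]
  exact mul_le_mul_of_nonpos_left hJ hwt

/-- The minorant is continuous on `[3, 4]`. [folklore] -/
theorem continuousOn_chen_lowerSieveMinorant :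
    ContinuousOn (fun u : ℝ => 1 / 2 - 9 / 4 / u - 1 / 4 / (5 - u) + 3 / 4 / (u - 1)) (Icc 3 4) := by
  refine ((continuousOn_const.sub ?_).sub ?_).add ?_
  · exact ContinuousOn.div continuousOn_const continuousOn_id fun t ht h0 => by
      have h0' : t = 0 := h0
      linarith [ht.1]
  · exact ContinuousOn.div continuousOn_const (by fun_prop) fun t ht h0 => by
      have h0' : 5 - t = 0 := h0
      linarith [ht.2]
  · exact ContinuousOn.div continuousOn_const (by fun_prop) fun t ht h0 => by
      have h0' : t - 1 = 0 := h0
      linarith [ht.1]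

/-- The weighted integrand `((5/2 − u)/(u(5 − u))) J(u − 1)` is continuous on `[3, 4]`. [folklore] -/
theorem continuousOn_chen_lowerSieveIntegrand :
    ContinuousOn (fun u : ℝ => (5 / 2 - u) / (u * (5 - u)) * linearSieveJ (u - 1)) (Icc 3 4) := by
  refine ContinuousOn.mul ?_ ?_
  · refine ContinuousOn.div (by fun_prop) (by fun_prop) fun t ht h0 => ?_
    rcases mul_eq_zero.mp h0 with h | h <;> linarith [ht.1, ht.2]
  · exact continuousOn_linearSieveJ.comp (continuousOn_id.sub continuousOn_const) fun t ht => by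
      show t - 1 ∈ Ioi 1
      rw [mem_Ioi]
      linarith [ht.1]

/-- `∫_3^4` of the minorant: `½ + 3 log 3 − (11/2) log 2`
(Chen: `½ − 2.25 log(4/3) − ¼ log 2 + 0.75 log(3/2) = ½ + 0.75 log(9/8) − 1.5 log(4/3) − ¼ log 2`).
[cite: ChenSciSinica1973, Lemma 9 eq. (33) (reprint p. 168)] -/
theorem integral_chen_lowerSieveMinorant :
    ∫ u in (3 : ℝ)..4, (1 / 2 - 9 / 4 / u - 1 / 4 / (5 - u) + 3 / 4 / (u - 1)) =
      1 / 2 + 3 * Real.log 3 - 11 / 2 * Real.log 2 := by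
  have hderiv : ∀ u ∈ uIcc (3 : ℝ) 4, HasDerivAt
      (fun u : ℝ => u / 2 - 9 / 4 * Real.log u + 1 / 4 * Real.log (5 - u) + 3 / 4 * Real.log (u - 1))
      (1 / 2 - 9 / 4 / u - 1 / 4 / (5 - u) + 3 / 4 / (u - 1)) u := by
    intro u hu
    rw [uIcc_of_le (by norm_num)] at hu
    have hu0 : u ≠ 0 := by linarith [hu.1]
    have hu5 : (5 : ℝ) - u ≠ 0 := by linarith [hu.2]
    have hu1 : u - 1 ≠ 0 := by linarith [hu.1]
    have hl0 : HasDerivAt (fun t : ℝ => Real.log t) u⁻¹ u := Real.hasDerivAt_log hu0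
    have hl5 : HasDerivAt (fun t : ℝ => Real.log (5 - t)) (-1 / (5 - u)) u := by
      have := ((hasDerivAt_id u).const_sub 5).log hu5
      simpa using this
    have hl1 : HasDerivAt (fun t : ℝ => Real.log (t - 1)) (1 / (u - 1)) u := by
      have := ((hasDerivAt_id u).sub_const 1).log hu1
      simpa using this
    have h : HasDerivAt
        (fun u : ℝ => u / 2 - 9 / 4 * Real.log u + 1 / 4 * Real.log (5 - u) + 3 / 4 * Real.log (u - 1))
        (1 / 2 - 9 / 4 * u⁻¹ + 1 / 4 * (-1 / (5 - u)) + 3 / 4 * (1 / (u - 1))) u :=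
      ((((hasDerivAt_id u).div_const 2).sub (hl0.const_mul (9 / 4 : ℝ))).add
        (hl5.const_mul (1 / 4 : ℝ))).add (hl1.const_mul (3 / 4 : ℝ))
    refine h.congr_deriv ?_
    field_simp
    ring
  rw [integral_eq_sub_of_hasDerivAt hderiv
    (continuousOn_chen_lowerSieveMinorant.intervalIntegrable_of_Icc (by norm_num))]
  have e4 : Real.log (4 : ℝ) = 2 * Real.log 2 := by
    rw [show (4 : ℝ) = 2 ^ 2 by norm_num, Real.log_pow]
    norm_num
  norm_num
  rw [e4]
  ring

/-- **Chen's (33)**: `∫_3^4 ((5/2 − u)/(u(5 − u))) J(u − 1) du ≥ ½ + 3 log 3 − (11/2) log 2`, i.e.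
`I₁ − ¼ I₂ ≥ ½ + ¾ log(9/8) − (3/2) log(4/3) − ¼ log 2` in Chen's notation.
[cite: ChenSciSinica1973, Lemma 9 eq. (33) (reprint p. 168)] -/
theorem chen_lowerSieveIntegral_ge :
    1 / 2 + 3 * Real.log 3 - 11 / 2 * Real.log 2 ≤
      ∫ u in (3 : ℝ)..4, (5 / 2 - u) / (u * (5 - u)) * linearSieveJ (u - 1) := by
  rw [← integral_chen_lowerSieveMinorant]
  exact integral_mono_on (by norm_num)
    (continuousOn_chen_lowerSieveMinorant.intervalIntegrable_of_Icc (by norm_num))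
    (continuousOn_chen_lowerSieveIntegrand.intervalIntegrable_of_Icc (by norm_num))
    fun u hu => chen_lowerSieveMinorant_le hu.1 hu.2

/-- **Chen's numerical value in (33)**: `½ + 3 log 3 − (11/2) log 2 > −0.016473`
(`= −0.01647262…`; Chen prints `≥ 0.588335 − 0.6048075 = −0.0164725`).
[cite: ChenSciSinica1973, Lemma 9 eq. (33) (reprint p. 168)] -/
theorem chen_lowerSieveConst_gt :
    (-0.016473 : ℝ) < 1 / 2 + 3 * Real.log 3 - 11 / 2 * Real.log 2 := by
  have hl2 := Real.log_two_lt_d9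
  have hl3 := Real.log_three_gt_d9
  norm_num at hl2 hl3 ⊢
  linarith

/-- **The numerical margin of Chen's Theorems I–II.** With Chen's parameters (`z = x^{1/10}`,
`y = x^{1/3}`) the three sieve estimates give the constant
`8(log 4 + I₁) − (4 log 8 + 2 I₂) − 4c' = 4 log 2 + 8(I₁ − ¼ I₂) − 4c'` in front of
`x C_x/(log x)²`, where `c' = ∫_{1/10}^{1/3} log(2 − 3α)/(α(1 − α)) dα < 0.4911`
(`Literature.NumberTheory.Sieve.Chen.switchingConstantTenth_lt`) and `I₁ − ¼ I₂ ≥ ½ + 3 log 3 − (11/2) log 2`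
(`chen_lowerSieveIntegral_ge`); numerically `4 log 2 + 8(½ + 3 log 3 − (11/2) log 2) − 4 · 0.4911 > 0.676`
(Chen, with his cruder `c' ≤ 0.49254`: `2.6408 − 1.9702 = 0.6706 ≥ 0.67`).
[cite: ChenSciSinica1973, §III (reprint p. 168)] -/
theorem chen_mainConstant_gt :
    (0.676 : ℝ) < 4 * Real.log 2 + 8 * (1 / 2 + 3 * Real.log 3 - 11 / 2 * Real.log 2) - 4 * 0.4911 := by
  have hl2 := Real.log_two_lt_d9
  have hl2' := Real.log_two_gt_d9
  have hl3 := Real.log_three_gt_d9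
  norm_num at hl2 hl2' hl3 ⊢
  linarith

end Literature.NumberTheory.Sieve.Chen
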